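import Mathlib
import Literature.Computability.AlgebraicComplexity.StandardFamilies
import Summits.ValiantsHypothesis.ValiantsHypothesis.Theses.RefutationDegree

/-!
# Row/column permutation invariance of `per_n` (line `Sketch`, crux `BeyondHessianNs`)

Helper file for crux item stmt-ValiantsHypothesis-5641 (`RefutationDegree.BeyondHessianNs`).

The generic permanent `per_n = ∑_π ∏_i X_{π i, i}` is invariant under independent permutations of
the rows and columns of the variable matrix, `X_{ij} ↦ X_{σ i, τ j}`: reindex the Leibniz sum by
`π ↦ σ π τ⁻¹` and the product by `τ`.  In the line this is what makes each of the `n²` permuted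
expressions `A.map (rename π_{ij})`, `π_{ij} e = (swap 0 i e.1, swap 0 j e.2)`, again an affine
determinantal expression of `per_n` (stub `stub_rename_perPoly` of the skeleton; the tree's
`rename_perPoly_equiv` is the diagonal case `σ = τ`).
-/

noncomputable section

-- `Summit.ValiantsHypothesis.ValiantsHypothesis.…` is the tree's mandated single-conjunct layout.
set_option linter.dupNamespace false

namespace Summit.ValiantsHypothesis.ValiantsHypothesis.Theorems.RefutationDegreeBeyondHessianNs

open MvPolynomial
open Literature.Computability.AlgebraicComplexity

/-- **`per_n` is invariant under independent row and column permutations**: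
`per (X_{σ i, τ j}) = per (X_{ij})`, i.e. `rename (e ↦ (σ e.1, τ e.2)) per_n = per_n`.
Reindex the Leibniz sum `∑_π ∏_i X_{π i, i}` by `π ↦ σ π τ⁻¹` and the product by `τ`.
[folklore] -/
theorem stub_rename_perPoly {K : Type*} [CommRing K] {n : ℕ} (σ τ : Equiv.Perm (Fin n)) :
    rename (fun e : Fin n × Fin n => (σ e.1, τ e.2)) (perPoly (Fin n) K) = perPoly (Fin n) K := by
  simp only [perPoly, Matrix.permanent, map_sum, map_prod, Matrix.mvPolynomialX_apply, rename_X]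
  refine Fintype.sum_equiv ((Equiv.mulLeft σ).trans (Equiv.mulRight τ⁻¹)) _ _ fun π => ?_
  refine Fintype.prod_equiv τ _ _ fun i => ?_
  simp [Equiv.Perm.mul_apply]

end Summit.ValiantsHypothesis.ValiantsHypothesis.Theorems.RefutationDegreeBeyondHessianNs

end
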